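import Literature.IUT.HodgeArakelov.ThetaGauChainDecision
import Literature.IUT.LogThetaLattice.LogThetaLatticeCoricityProofs
import Literature.IUT.LogThetaLattice.FrobeniusChainCoricOfKits
import Literature.IUT.LogThetaLattice.LatticeDiagramOfKitsTaggedToy
import Mathlib.CategoryTheory.InducedCategory
import HarnessLib

/-!
# [IUTchII] Cor 4.10 (vi) POSITIVE at `StripFrame.ofKits`: tagging the `ℱ^⊩`-side of ANY kit gives the assembled frame a chain
# of distinct `Θ^{±ell}NF`-Hodge theaters; at the bi-tagged toy kit all three «distinct collection» clauses hold at once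

Mochizuki, *Inter-universal Teichmüller Theory II*, kurims manuscript (Dec 2020), Cor 4.10 (vi) p. 161 ("a collection of distinct
`Θ^{±ell}NF`-Hodge theaters indexed by the integers"); *III* (May 2020) Def 1.1 p. 23, Prop 1.2 (x) p. 34, Def 1.4 p. 45; *I* (May 2020)
Def 5.2 (iv) pp. 134–135 ("`ℱ^⊩`-prime-strips … isomorphic to the collection of data `ℱ^⊩_mod`", "a morphism … is an isomorphism
between collections of data"), Rmk 5.2.1 (ii) p. 143, Cor 5.3 (ii)(iii) p. 144. abc-iut cell, seat abc-iut-w5-d043 (L6 NV row «NV-W2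
IUTchIII:Def1.4», part W2b); sequel to `LatticeDiagramOfKitsTaggedToy.lean` / `ChainsOfKitsTaggedToy.lean` and to abc-iut-w5-d193's
`ThetaGauChainDecision.lean` / `ThetaGauChainOfKits.lean`, whose criterion (chain ⇐ infinitely many `ℱ^⊩`-prime-strips,
`ThetaGauChain.nonempty_of_infinite_obj` / `StripFrame.nonempty_thetaGauChain_ofKits_of_infinite_frStrip`) had NO kit to fire on
(`KitsToy.isEmpty_thetaGauChain`; likewise at the `FAmb`-tagged toy kit, whose `ℱ^⊩`-side is the toy's).

§ 1 GENERIC (every base kit, every `FK : K.FKit M`): the `ℱ^⊩`-TAGGED kit **`FK.tagRlf ι i₀`** — the ambient category of collections of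
data `RlfAmb` replaced by `InducedCategory FK.RlfAmb Prod.snd` on `ι × FK.RlfAmb` (every collection of data duplicated `ι` times, the
copies canonically isomorphic; model and `‡𝔉 ↦ ‡𝔉^⊩` tagged `i₀`; EVERYTHING ELSE — `ℱ`-, `ℱ^⊢`-, `𝒟^⊢`-sides — verbatim), with the
transfers of abc-iut-L5-d4's `MonoLaws`, of [IUTchI] Cor 5.3 (ii), (iii) and Rmk 5.2.1 (ii) (`MonoLaws.tagRlf`, `isomFtoDBijective_tagRlf`,
`isomFmtoDmSurjective_tagRlf`, `rlfOfIsStrip_tagRlf` — one-liners: these statements never look at the `ℱ^⊩`-side beyond `rlfOf`), of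
the [IUTchII] Def 4.9 input `TimesMuSide` (`TimesMuSide.tagRlf`: same `F^{⊢×μ}`/`F^{⊢▶×μ}`/`F^{⊩▶×μ}` categories, the functors
precomposed with forgetting the tag), the injective family `frStripTag` of `ℱ^⊩`-prime-strips, `infinite_frStrip_tagRlf`, and
**`StripFrame.nonempty_thetaGauChain_ofKits_tagRlf`**: for `ι` infinite, the frame assembled from the tagged kit CARRIES a chain of
distinct `Θ^{±ell}NF`-Hodge theaters — for EVERY kit datum `(FK, L, hbij, hsurj, hR, X)` of the tree's `StripFrame.ofKits` signature.
§ 2 AT abc-iut-L5-t4's TOY kit: `KitsToy.nonempty_thetaGauChain_tagRlf` (contrast `KitsToy.isEmpty_thetaGauChain`).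
§ 3 AT THE BI-TAGGED TOY KIT `(FKit.toyTagged l hl).tagRlf (ℤ × ℤ) (0,0)` (this seat's `FAmb`-tagging composed with the
`ℱ^⊩`-tagging): ALL THREE «distinct collection» clauses of [IUTchIII] §1 / [IUTchII] §4 hold at ONE `StripFrame.ofKits` instance —
Def 1.4 (`KitsBiTaggedToy.latticeDiagram`, via abc-iut-L6-t3's `LogThetaLatticeDiagram.ofKits`), Prop 1.2 (x) (`nonempty_frobeniusChain`,
abc-iut-w5-d005's criterion) and Cor 4.10 (vi) (`nonempty_thetaGauChain`) — `KitsBiTaggedToy.distinct_collections`.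

HONEST LABEL (abc-iut-L6-lead §F v1.19j (1)): tagged copies of ONE toy model realise print's "distinct copies indexed by (pairs of)
integers"; § 1 is bookkeeping about the kit signature (tags are invisible to every rigidity statement), §§ 2–3 are consistency /
non-vacuity witnesses over TOY kits, NOT genuine Hodge theaters; nothing here bears on the real-kit line (abc-iut-L5-t4). No Prop fact,
no instance. Consistency ≠ endorsement; typed ≠ proved; no side taken on [IUTchIII] Cor 3.12. [claim: Mochizuki2012, status: disputed]
-/

noncomputable section

/-! ### 1. Tagging the `ℱ^⊩`-side of a kit -/

namespace Literature.IUT.HodgeTheaters.PMBaseKit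

open CategoryTheory

universe u

variable {l : ℕ} {K : PMBaseKit.{u} l} {M : K.MultKit}

namespace FKit

variable (FK : K.FKit M) (ι : Type u) (i₀ : ι)

/-- **IUTchI:Def5.2(iv)** (kurims p.134) **The `ℱ^⊩`-tagged kit**: `FK` with the ambient category of "collections of data
`(‡𝒞^⊩, Prime(‡𝒞^⊩) ⥲ 𝕍, ‡𝔉^⊢, {‡ρ_v})`" replaced by its `ι`-fold tagged copy `InducedCategory FK.RlfAmb Prod.snd` (copies canonically
isomorphic, the forgetful functor fully faithful); the model `ℱ^⊩_mod` and the algorithm `‡𝔉 ↦ ‡𝔉^⊩` (Rmk 5.2.1 (ii)) carry the tag `i₀`;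
the `ℱ`-, `ℱ^⊢`-, `ℱ̲`- and `𝒟^⊢`-sides are those of `FK` verbatim. [claim: Mochizuki2012, status: disputed] -/
def tagRlf : K.FKit M where
  FAmb := FK.FAmb
  fModel := FK.fModel
  FmAmb := FK.FmAmb
  fmModel := FK.fmModel
  toD := FK.toD
  toD_model := FK.toD_model
  toFm := FK.toFm
  toFm_model := FK.toFm_model
  RlfAmb := InducedCategory FK.RlfAmb (Prod.snd : ι × FK.RlfAmb → FK.RlfAmb)
  rlfModel := (i₀, FK.rlfModel)
  rlfFm v := inducedFunctor _ ⋙ FK.rlfFm v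
  rlfOf F := (i₀, FK.rlfOf F)
  rlfOfMap φ := InducedCategory.isoMk (FK.rlfOfMap φ)
  rlfFm_rlfOf F v := FK.rlfFm_rlfOf F v
  ThAmb := FK.ThAmb
  thModel := FK.thModel
  thToF := FK.thToF
  thToF_model := FK.thToF_model
  toDm := FK.toDm
  toDmMap φ := FK.toDmMap φ
  toDm_toFm F hF := FK.toDm_toFm F hF

variable {FK}

/-- **IUTchI:Def5.2(i)** (kurims p.134) An `ℱ`-prime-strip of the `ℱ^⊩`-tagged kit read as one of `FK` (same constituents).
[claim: Mochizuki2012, status: disputed] -/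
abbrev FStrip.untagRlf (F : (FK.tagRlf ι i₀).FStrip) : FK.FStrip := ⟨F.obj, F.isModel⟩

/-- **IUTchI:Def5.2(ii)** (kurims p.134) An `ℱ^⊢`-prime-strip of the `ℱ^⊩`-tagged kit read as one of `FK` (same constituents).
[claim: Mochizuki2012, status: disputed] -/
abbrev FmStrip.untagRlf (F : (FK.tagRlf ι i₀).FmStrip) : FK.FmStrip := ⟨F.obj, F.isModel⟩

/-- **IUTchI:Rmk5.2.1(i)** (kurims p.143) abc-iut-L5-d4's `MonoLaws` transfer to the `ℱ^⊩`-tagged kit (they concern `𝔉^⊢ ↦ 𝔇^⊢`,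
`𝔇 ↦ 𝔇^⊢` and `(‡𝔉^⊢)^{𝒟^⊢} ≅ (‡𝔇)^⊢` only — all unchanged). [claim: Mochizuki2012, status: disputed] -/
def MonoLaws.tagRlf (L : FK.MonoLaws) : (FK.tagRlf ι i₀).MonoLaws where
  toDmMap_refl F := L.toDmMap_refl F
  toDmMap_trans φ ψ := L.toDmMap_trans φ ψ
  monoMap_refl D := L.monoMap_refl D
  monoMap_trans φ ψ := L.monoMap_trans φ ψ
  toDmToFm F := L.toDmToFm (FStrip.untagRlf ι i₀ F)
  toDmToFm_natural {F₁ F₂} φ := L.toDmToFm_natural (F₁ := FStrip.untagRlf ι i₀ F₁) (F₂ := FStrip.untagRlf ι i₀ F₂) φ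

/-- **IUTchI:Cor5.3(ii)** (kurims p.144) Cor 5.3 (ii) (`Isom(¹𝔉, ²𝔉) → Isom(¹𝔇, ²𝔇)` bijective) transfers VERBATIM to the `ℱ^⊩`-tagged kit.
[claim: Mochizuki2012, status: disputed] -/
theorem isomFtoDBijective_tagRlf (h : FK.IsomFtoDBijective) : (FK.tagRlf ι i₀).IsomFtoDBijective :=
  fun F₁ F₂ => h (FStrip.untagRlf ι i₀ F₁) (FStrip.untagRlf ι i₀ F₂)

/-- **IUTchI:Cor5.3(iii)** (kurims p.144) Cor 5.3 (iii) (`Isom(¹𝔉^⊢, ²𝔉^⊢) → Isom(¹𝔇^⊢, ²𝔇^⊢)` surjective) transfers VERBATIM.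
[claim: Mochizuki2012, status: disputed] -/
theorem isomFmtoDmSurjective_tagRlf (h : FK.IsomFmtoDmSurjective) : (FK.tagRlf ι i₀).IsomFmtoDmSurjective :=
  fun F₁ F₂ => h (FmStrip.untagRlf ι i₀ F₁) (FmStrip.untagRlf ι i₀ F₂)

/-- **IUTchI:Rmk5.2.1(ii)** (kurims p.143) Rmk 5.2.1 (ii) ("`‡𝔉 ↦ ‡𝔉^⊩` forms an `ℱ^⊩`-prime-strip") transfers: the tag-`i₀` copy of an
isomorph of `ℱ^⊩_mod` is an isomorph of the tag-`i₀` copy of `ℱ^⊩_mod`. [claim: Mochizuki2012, status: disputed] -/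
theorem rlfOfIsStrip_tagRlf (h : FK.RlfOfIsStrip) : (FK.tagRlf ι i₀).RlfOfIsStrip :=
  fun F => ⟨InducedCategory.isoMk (h (FStrip.untagRlf ι i₀ F)).some⟩

/-- **IUTchI:Def5.2(ii)** (kurims p.134) Forgetting the (absent) tag on `ℱ^⊢`-prime-strips, functorially (abc-iut-L6-t7's groupoids).
[claim: Mochizuki2012, status: disputed] -/
def fmStripUntagRlf : (FK.tagRlf ι i₀).FmStrip ⥤ FK.FmStrip where
  obj F := FmStrip.untagRlf ι i₀ F
  map φ := φ
  map_id _ := rfl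
  map_comp _ _ := rfl

/-- **IUTchI:Def5.2(iv)** (kurims p.135) Forgetting the tag on `ℱ^⊩`-prime-strips, functorially ("a morphism of `ℱ^⊩`-prime-strips is
… an isomorphism between collections of data"). [claim: Mochizuki2012, status: disputed] -/
def frStripUntagRlf : (FK.tagRlf ι i₀).FrStrip ⥤ FK.FrStrip where
  obj F := ⟨F.obj.2, ⟨(inducedFunctor _).mapIso F.isModel.some⟩⟩
  map φ := (inducedFunctor _).mapIso φ
  map_id _ := rfl
  map_comp _ _ := rfl

/-- **IUTchI:Def5.2(iv)** (kurims p.135) The copy with tag `p` of the model collection of data `ℱ^⊩_mod` is an `ℱ^⊩`-prime-strip of the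
tagged kit. [claim: Mochizuki2012, status: disputed] -/
def frStripTag (p : ι) : (FK.tagRlf ι i₀).FrStrip :=
  ⟨(p, FK.rlfModel), ⟨InducedCategory.isoMk (Iso.refl _)⟩⟩

/-- **IUTchI:Def5.2(iv)** (kurims p.135) The tag is read off the collection of data. [claim: Mochizuki2012, status: disputed] -/
theorem frStripTag_obj (p : ι) : (frStripTag ι i₀ (FK := FK) p).obj = (p, FK.rlfModel) := rfl

/-- **IUTchI:Def5.2(iv)** (kurims p.135) Distinct tags give DISTINCT `ℱ^⊩`-prime-strips. [claim: Mochizuki2012, status: disputed] -/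
theorem frStripTag_injective : Function.Injective (frStripTag ι i₀ (FK := FK)) := by
  intro p q h
  have h' := congrArg (fun F : (FK.tagRlf ι i₀).FrStrip => (F.obj : ι × FK.RlfAmb).1) h
  simpa [frStripTag_obj] using h'

/-- **IUTchI:Def5.2(iv)** (kurims p.135) For an infinite tag type the tagged kit has INFINITELY MANY `ℱ^⊩`-prime-strips (in print the
isomorphs of `ℱ^⊩_mod` form a proper class). [claim: Mochizuki2012, status: disputed] -/
theorem infinite_frStrip_tagRlf [Infinite ι] : Infinite (FK.tagRlf ι i₀).FrStrip :=
  Infinite.of_injective _ (frStripTag_injective ι i₀ (FK := FK))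

end FKit

end Literature.IUT.HodgeTheaters.PMBaseKit

namespace Literature.IUT.LogThetaLattice

open CategoryTheory
open Literature.IUT.HodgeArakelov Literature.IUT.HodgeTheaters Literature.IUT.HodgeTheaters.PMBaseKit

universe u

section Generic

variable {l : ℕ} {K : PMBaseKit.{u} l} {M : K.MultKit} {FK : K.FKit M} {L : FK.MonoLaws} (ι : Type u) (i₀ : ι)

/-- **IUTchII:Def4.9(vii)** (kurims p.158) The [IUTchII] Def 4.9 input `TimesMuSide` transfers to the `ℱ^⊩`-tagged kit: the SAME categories
of `F^{⊢×μ}`-, `F^{⊢▶×μ}`-, `F^{⊩▶×μ}`-prime-strips and the same functors, precomposed with forgetting the tag.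
[claim: Mochizuki2012, status: disputed] -/
def TimesMuSide.tagRlf (X : TimesMuSide FK L) : TimesMuSide (FK.tagRlf ι i₀) (L.tagRlf ι i₀) where
  Fxm := X.Fxm
  Fvtxm := X.Fvtxm
  Fglxm := X.Fglxm
  FvToFxm := FKit.fmStripUntagRlf ι i₀ ⋙ X.FvToFxm
  FxmToDv := X.FxmToDv
  FglToFglxm := FKit.frStripUntagRlf ι i₀ ⋙ X.FglToFglxm
  FglxmToFvtxm := X.FglxmToFvtxm
  FvtxmToFxm := X.FvtxmToFxm
  fxm_comm := Functor.isoWhiskerLeft (FKit.fmStripUntagRlf ι i₀) X.fxm_comm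
  iso_nonempty_Fxm := X.iso_nonempty_Fxm
  iso_nonempty_Fglxm := X.iso_nonempty_Fglxm

variable (L) (hbij : FK.IsomFtoDBijective) (hsurj : FK.IsomFmtoDmSurjective) (hR : FK.RlfOfIsStrip) (X : TimesMuSide FK L)

/-- **IUTchIII:Def1.1** (kurims p.23) The frame assembled from the `ℱ^⊩`-tagged kit datum. [claim: Mochizuki2012, status: disputed] -/
abbrev StripFrame.ofKitsTagRlf : StripFrame.{max 1 u} :=
  StripFrame.ofKits (L.tagRlf ι i₀) (FKit.isomFtoDBijective_tagRlf ι i₀ hbij) (FKit.isomFmtoDmSurjective_tagRlf ι i₀ hsurj)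
    (FKit.rlfOfIsStrip_tagRlf ι i₀ hR) (X.tagRlf ι i₀)

/-- **IUTchII:Cor4.10(vi)** (kurims p.161) **POSITIVE at `StripFrame.ofKits`, for EVERY kit datum**: after tagging the `ℱ^⊩`-side by an
infinite type, the assembled frame CARRIES a collection of DISTINCT `Θ^{±ell}NF`-Hodge theaters indexed by `ℤ` through their strips
(abc-iut-w5-d193's criterion `ThetaGauChain.nonempty_of_infinite_obj` at `ThetaLinkSetting.ofStripFrame`, fired on `infinite_frStrip_tagRlf`
transported to the small `F^⊩`-prime-strips).
[claim: Mochizuki2012, status: disputed] -/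
theorem StripFrame.nonempty_thetaGauChain_ofKits_tagRlf [Infinite ι] :
    Nonempty (ThetaGauChain (ThetaLinkSetting.ofStripFrame (StripFrame.ofKitsTagRlf L ι i₀ hbij hsurj hR X))) :=
  haveI : Infinite (StripFrame.ofKitsTagRlf L ι i₀ hbij hsurj hR X).Fgl :=
    haveI := FKit.infinite_frStrip_tagRlf ι i₀ (FK := FK)
    Infinite.of_injective (fun F : (FK.tagRlf ι i₀).FrStrip => (AsSmall.up.obj F : AsSmall.{max 1 u} _))
      fun _ _ hFG => congrArg ULift.down hFG
  ThetaGauChain.nonempty_of_infinite_obj _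

/-- **IUTchII:Cor4.10(iv)** (kurims p.160) … and then the consumers quantified over such chains are instantiated there: along some chain
"`(−)F^{⊢×μ}_△` is an invariant of both links" (abc-iut-L6-d1's `unitMuCoric_chain`, given [IUTchIII] Prop 2.1 / Thm 2.2 data `T`).
[claim: Mochizuki2012, status: disputed] -/
theorem StripFrame.exists_thetaGauChain_unitMuCoric_ofKits_tagRlf [Infinite ι]
    (T : ThetaMonoidData (StripFrame.ofKitsTagRlf L ι i₀ hbij hsurj hR X)) :
    ∃ P : ThetaGauChain (ThetaLinkSetting.ofStripFrame (StripFrame.ofKitsTagRlf L ι i₀ hbij hsurj hR X)),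
      ∀ n : ℤ, (P.theater n).UnitMuCoric (P.theater (n + 1)) :=
  by
  obtain ⟨P⟩ := StripFrame.nonempty_thetaGauChain_ofKits_tagRlf L ι i₀ hbij hsurj hR X
  exact ⟨P, fun n => unitMuCoric_chain T P n⟩

end Generic

/-! ### 2. At abc-iut-L5-t4's toy kit -/

namespace KitsToy

variable (l : ℕ) [Fact l.Prime] (hl : l ≠ 2)

/-- **IUTchII:Cor4.10(vi)** (kurims p.161) At the `ℱ^⊩`-TAGGED toy kit (tags `ℤ`) the assembled frame carries a chain of distinct
`Θ^{±ell}NF`-Hodge theaters — contrast `KitsToy.isEmpty_thetaGauChain` (abc-iut-w5-d193) at the untagged toy frame.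
[claim: Mochizuki2012, status: disputed] -/
theorem nonempty_thetaGauChain_tagRlf :
    Nonempty (ThetaGauChain (ThetaLinkSetting.ofStripFrame
      (StripFrame.ofKitsTagRlf (FKit.MonoLaws.toy l hl) ℤ (0 : ℤ) (FKit.isomFtoDBijective_toy l hl)
        (FKit.isomFmtoDmSurjective_toy l hl) (FKit.rlfOfIsStrip_toy l hl) (KitsToy.timesMuSide l hl)))) :=
  StripFrame.nonempty_thetaGauChain_ofKits_tagRlf _ ℤ 0 _ _ _ _

end KitsToy

/-! ### 3. The bi-tagged toy kit: all three «distinct collection» clauses at one `StripFrame.ofKits` -/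

namespace KitsBiTaggedToy

variable (l : ℕ) [Fact l.Prime] (hl : l ≠ 2)

/-- **IUTchI:Def5.2(i)** (kurims p.134) The BI-TAGGED toy kit: this seat's `FAmb`-tagged toy kit `FKit.toyTagged l hl` with its
`ℱ^⊩`-side tagged as well (tags `ℤ × ℤ`, base tag `(0,0)`). [claim: Mochizuki2012, status: disputed] -/
abbrev kit : (toyKit l hl).FKit (MultKit.toy l hl) := (FKit.toyTagged l hl).tagRlf (ℤ × ℤ) ((0 : ℤ), (0 : ℤ))

/-- **IUTchI:Rmk5.2.1(i)** (kurims p.143) Its `MonoLaws` (transferred). [claim: Mochizuki2012, status: disputed] -/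
abbrev laws : (kit l hl).MonoLaws := (FKit.MonoLaws.toyTagged l hl).tagRlf (ℤ × ℤ) ((0 : ℤ), (0 : ℤ))

/-- **IUTchI:Cor5.3(ii)** (kurims p.144) Cor 5.3 (ii) holds over the bi-tagged kit (transferred). [claim: Mochizuki2012, status: disputed] -/
theorem isomFtoDBijective : (kit l hl).IsomFtoDBijective :=
  FKit.isomFtoDBijective_tagRlf _ _ (FKit.isomFtoDBijective_toyTagged l hl)

/-- **IUTchI:Cor5.3(iii)** (kurims p.144) Cor 5.3 (iii) holds over the bi-tagged kit (transferred). [claim: Mochizuki2012, status: disputed] -/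
theorem isomFmtoDmSurjective : (kit l hl).IsomFmtoDmSurjective :=
  FKit.isomFmtoDmSurjective_tagRlf _ _ (FKit.isomFmtoDmSurjective_toyTagged l hl)

/-- **IUTchI:Rmk5.2.1(ii)** (kurims p.143) Rmk 5.2.1 (ii) holds over the bi-tagged kit (transferred). [claim: Mochizuki2012, status: disputed] -/
theorem rlfOfIsStrip : (kit l hl).RlfOfIsStrip :=
  FKit.rlfOfIsStrip_tagRlf _ _ (FKit.rlfOfIsStrip_toyTagged l hl)

/-- **IUTchII:Def4.9(vii)** (kurims p.158) The [IUTchII] Def 4.9 input over the bi-tagged kit (transferred). [claim: Mochizuki2012, status: disputed] -/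
abbrev timesMuSide : TimesMuSide (kit l hl) (laws l hl) :=
  (KitsTaggedToy.timesMuSide l hl).tagRlf (ℤ × ℤ) ((0 : ℤ), (0 : ℤ))

/-- **IUTchIII:Def1.1** (kurims p.23) The frame assembled from the bi-tagged toy kit. [claim: Mochizuki2012, status: disputed] -/
abbrev frame : StripFrame.{1} :=
  StripFrame.ofKits (laws l hl) (isomFtoDBijective l hl) (isomFmtoDmSurjective l hl) (rlfOfIsStrip l hl) (timesMuSide l hl)

/-- **IUTchIII:Def1.1(i)** (kurims p.24) The log-Frobenius datum `log := 𝟭` over the bi-tagged kit. [claim: Mochizuki2012, status: disputed] -/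
def logKit : LogKit (kit l hl) where
  log _ := 𝟭 _
  log_model _ := ⟨Iso.refl _⟩
  logD v := ((kit l hl).toD v).leftUnitor

/-- **IUTchIII:Def1.1(iii)** (kurims p.26) The §1 log-strip interface over the bi-tagged frame. [claim: Mochizuki2012, status: disputed] -/
def logStripData : LogStripData (frame l hl) :=
  LogStripData.ofKits (laws l hl) (isomFtoDBijective l hl) (isomFmtoDmSurjective l hl) (rlfOfIsStrip l hl)
    (timesMuSide l hl) (logKit l hl)

/-- **IUTchII:Cor4.10(i)** (kurims p.158) The `ThetaLinkKit` over the bi-tagged `TimesMuSide` (pilots constant at the model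
`ℱ^⊩`-prime-strip of the `F^{⊩▶×μ}`-category, which the `ℱ^⊩`-tagging leaves untouched; "coincides with the full poly-isomorphism"
because the `F^{⊢×μ}`-groupoid has one isomorphism between any two objects). [claim: Mochizuki2012, status: disputed] -/
def thetaLinkKit : ThetaLinkKit (timesMuSide l hl) where
  pilotDelta := (Functor.const _).obj (KitsTaggedToy.frStrip l hl)
  pilotTheta _ := (Functor.const _).obj (KitsTaggedToy.frStrip l hl)
  unitPortion _ := Iso.refl _
  induced_full k H H' := by
    rw [← Literature.IUT.HodgeArakelov.mapIso_surjective_iff_map_full]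
    intro e
    exact ⟨Iso.refl _, KitsTaggedToy.iso_eq_of_timesMuSide_Fxm l hl _ _⟩

/-- **IUTchII:Cor4.10(iii)** (kurims p.160) `ThetaLinkData.ofKits` over the bi-tagged frame. [claim: Mochizuki2012, status: disputed] -/
def thetaLinkData : ThetaLinkData (frame l hl) :=
  ThetaLinkData.ofKits (laws l hl) (isomFtoDBijective l hl) (isomFmtoDmSurjective l hl) (rlfOfIsStrip l hl)
    (timesMuSide l hl) (thetaLinkKit l hl)

/-- **IUTchI:Def6.11(iii)** (kurims p.173) The family `p ↦ ^{p}ℋ𝒯` of `Θ^{±ell}`-Hodge theaters over the bi-tagged kit (this seat's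
`KitsTaggedToy.thetaPMEllHT p` re-read: the `ℱ`-side is unchanged by the `ℱ^⊩`-tagging). [claim: Mochizuki2012, status: disputed] -/
def thetaPMEllHT (p : ℤ × ℤ) : (kit l hl).ThetaPMEllHT where
  T := ZMod l
  grpT := FlPMGroup.tautological l
  capsule _ := ⟨(KitsTaggedToy.fStrip l hl ((0 : ℤ), (0 : ℤ))).obj, (KitsTaggedToy.fStrip l hl ((0 : ℤ), (0 : ℤ))).isModel⟩
  codomain := ⟨(KitsTaggedToy.fStrip l hl p).obj, (KitsTaggedToy.fStrip l hl p).isModel⟩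
  glob := (toyKit l hl).gModel
  dPolyPM := Ex62.poly (toyKit l hl)
  dPolyEll := Ex63.poly (toyKit l hl)
  exists_model := (Ex62.ht (K := toyKit l hl)).exists_model

/-- **IUTchIII:Def1.4** (kurims p.45) "Distinct": the family is injective (tag read off the codomain `ℱ`-prime-strip).
[claim: Mochizuki2012, status: disputed] -/
theorem thetaPMEllHT_injective : Function.Injective (thetaPMEllHT l hl) := by
  intro p q h
  have h' := congrArg (fun H : (kit l hl).ThetaPMEllHT => (H.codomain.obj () : (ℤ × ℤ) × Model.Obj l).1) h
  simpa [thetaPMEllHT, KitsTaggedToy.fStrip] using h'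

/-- **IUTchIII:Def1.4** (kurims p.45) [IUTchIII] Def 1.4 over the bi-tagged kit: the log-theta-lattice (abc-iut-L6-t3's
`LogThetaLatticeDiagram.ofKits` on the injective family). [claim: Mochizuki2012, status: disputed] -/
def latticeDiagram (kind : LatticeKind) : LogThetaLatticeDiagram (logStripData l hl) (thetaLinkData l hl) :=
  LogThetaLatticeDiagram.ofKits (laws l hl) (isomFtoDBijective l hl) (isomFmtoDmSurjective l hl) (rlfOfIsStrip l hl)
    (timesMuSide l hl) (thetaLinkKit l hl) (logKit l hl) kind (thetaPMEllHT l hl) (thetaPMEllHT_injective l hl)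

/-- **IUTchI:Def5.2(i)** (kurims p.134) The bi-tagged kit has infinitely many `ℱ`-prime-strips (the `FAmb`-tags).
[claim: Mochizuki2012, status: disputed] -/
theorem infinite_fStrip : Infinite (kit l hl).FStrip :=
  Infinite.of_injective
    (fun p : ℤ × ℤ => (⟨(KitsTaggedToy.fStrip l hl p).obj, (KitsTaggedToy.fStrip l hl p).isModel⟩ : (kit l hl).FStrip))
    fun p q h => by
      simpa [KitsTaggedToy.fStrip] using
        congrArg (fun F : (kit l hl).FStrip => (F.obj () : (ℤ × ℤ) × Model.Obj l).1) h

/-- **IUTchIII:Prop1.2(x)** (kurims p.34) [IUTchIII] Prop 1.2 (x) at the bi-tagged frame: a Frobenius-picture chain of DISTINCT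
`ℱ`-prime-strips EXISTS (abc-iut-w5-d005's criterion). [claim: Mochizuki2012, status: disputed] -/
theorem nonempty_frobeniusChain :
    Nonempty (FrobeniusChain (Literature.IUT.LogThetaLattice.KitsBiTaggedToy.frame l hl)) :=
  (FrobeniusChain.nonempty_ofKits_iff _ _ _ _ _).2 (infinite_fStrip l hl)

/-- **IUTchII:Cor4.10(vi)** (kurims p.161) [IUTchII] Cor 4.10 (vi) at the bi-tagged frame: a chain of DISTINCT `Θ^{±ell}NF`-Hodge
theaters through their strips EXISTS (§ 1). [claim: Mochizuki2012, status: disputed] -/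
theorem nonempty_thetaGauChain :
    Nonempty (ThetaGauChain (ThetaLinkSetting.ofStripFrame (Literature.IUT.LogThetaLattice.KitsBiTaggedToy.frame l hl))) :=
  StripFrame.nonempty_thetaGauChain_ofKits_tagRlf (FKit.MonoLaws.toyTagged l hl) (ℤ × ℤ) ((0 : ℤ), (0 : ℤ))
    (FKit.isomFtoDBijective_toyTagged l hl) (FKit.isomFmtoDmSurjective_toyTagged l hl) (FKit.rlfOfIsStrip_toyTagged l hl)
    (KitsTaggedToy.timesMuSide l hl)

/-- **IUTchIII:Def1.4** (kurims p.45) **ALL THREE «distinct collection» clauses at ONE `StripFrame.ofKits` instance** — Def 1.4's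
log-theta-lattice, Prop 1.2 (x)'s Frobenius-picture chain and [IUTchII] Cor 4.10 (vi)'s chain of theaters all EXIST at the
bi-tagged toy frame (at the untagged toy frame none does; at the `FAmb`-tagged one the third does not).
[claim: Mochizuki2012, status: disputed] -/
theorem distinct_collections (kind : LatticeKind) :
    Nonempty (LogThetaLatticeDiagram (Literature.IUT.LogThetaLattice.KitsBiTaggedToy.logStripData l hl)
        (Literature.IUT.LogThetaLattice.KitsBiTaggedToy.thetaLinkData l hl)) ∧
      Nonempty (FrobeniusChain (Literature.IUT.LogThetaLattice.KitsBiTaggedToy.frame l hl)) ∧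
        Nonempty (ThetaGauChain (ThetaLinkSetting.ofStripFrame
          (Literature.IUT.LogThetaLattice.KitsBiTaggedToy.frame l hl))) :=
  ⟨⟨latticeDiagram l hl kind⟩, nonempty_frobeniusChain l hl, nonempty_thetaGauChain l hl⟩

end KitsBiTaggedToy

end Literature.IUT.LogThetaLattice

end
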